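import Summits.CriticalPhenomena.SAWScalingLimit.Theorems.SAWDefectDecoherenceBoundaryClosureRBoundaryBookkeepingPath
import HarnessLib

/-!
# The floor profile of a potential in the root frame: `Re H` is monotone along each flat arm
(crux `BoundaryClosureR`, stmt-CriticalPhenomena-14004, line `pick-half-plane`, engine input S3-b;
registered sub-goal `pickEngine_floorProfile`)

Landing target:
`Summits/CriticalPhenomena/SAWScalingLimit/Theorems/SAWDefectDecoherenceBoundaryClosureRFloorProfile.lean`
(`--supports stmt-CriticalPhenomena-14004`).

For a potential `H` of `F dz` rooted at a floor dart `floorEdge ka m` lying inside an exact flat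
floor `k₁ … k₂` of row `m` of a simply connected `Λ`, worker w-boundary's EXACT floor step
(`BoundaryExactness.re_floor_step`: crossing the dual of `floorEdge k m` eastwards changes `Re H` by
`+K·Z(floorEdge k m)` east of the root and by `−K·Z(floorEdge k m)` west of it,
`K = (√3/6)·sin(3π/8)`, `Z = ‖F_{x_c,0}‖` the arrival mass) telescopes along the floor sites
`![k, m]`:

* `re_floor_profile_east`: for `ka < k`, `k + n ≤ k₂ + 1`,
  `Re H(![k+n, m]) − Re H(![k, m]) = K · Σ_{i<n} Z(floorEdge (k+i) m)`;
* `re_floor_profile_west`: for `k₁ ≤ k`, `k + n ≤ ka`,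
  `Re H(![k, m]) − Re H(![k+n, m]) = K · Σ_{i<n} Z(floorEdge (k+i) m)`;

so `Re H` is MONOTONE along each arm, increasing away from the root, with increments bounded by the
floor-dart masses (`pickEngine_floorProfile`, two-sided `0 ≤ … ≤ K Σ` form, no-pinch floor clause).
Sources: H. Duminil-Copin, S. Smirnov, Ann. of Math. 175 (2012), §3–§4.
-/

noncomputable section

open scoped BigOperators
open Finset
open Literature.Probability.LatticeModels Literature.Probability.RandomPlanarGeometry
open Literature.Probability.RandomPlanarGeometry.SAW
open Summit.CriticalPhenomena.SAWScalingLimit.Theorems.PickHalfPlane.BoundaryExactness (re_floor_step)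

namespace Summit.CriticalPhenomena.SAWScalingLimit.Theorems.PickHalfPlane.GateMass

/-! ### 21. Telescoping the exact floor steps -/

/-- The floor-step constant `K = (√3/6)·sin(3π/8)` is positive. [folklore] -/
theorem floorStepConst_pos : 0 < Real.sqrt 3 / 6 * Real.sin (3 / 8 * Real.pi) :=
  mul_pos (by positivity) (Real.sin_pos_of_pos_of_lt_pi (by positivity) (by nlinarith [Real.pi_pos]))

/-- The site `n + 1` columns east of `![k, m]` is one column east of the site `n` columns east.
[folklore] -/
theorem site_east_succ (k m : ℤ) (n : ℕ) :
    (![k + ((n + 1 : ℕ) : ℤ), m] : Site 2) = ![k + (n : ℤ) + 1, m] := by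
  ext i; fin_cases i
  · simp; ring
  · simp

/-- **East floor profile**: for a potential rooted at the floor dart `floorEdge ka m` of an exact flat
floor `k₁ … k₂` (simply connected `Λ`), east of the root `Re H` increases eastwards by exactly
`K · Z(floorEdge j m)` per crossed floor dart: for `ka < k` and `k + n ≤ k₂ + 1`,
`Re H(![k+n, m]) − Re H(![k, m]) = K · Σ_{i<n} Z(floorEdge (k+i) m)`.
[cite: DuminilCopinSmirnov2012, §3–§4 (winding of walks to the boundary; the map H)] -/
theorem re_floor_profile_east {Λ : Finset HexVertex} (hΛ : hexDomainSimplyConnected Λ)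
    {m k₁ k₂ ka : ℤ}
    (hF : ∀ k : ℤ, k₁ ≤ k → k ≤ k₂ → ((![k, m], 0) : HexVertex) ∈ Λ ∧
      ((![k, m - 1], 1) : HexVertex) ∉ Λ ∧ (k < k₂ → ((![k, m], 1) : HexVertex) ∈ Λ))
    (hka₁ : k₁ ≤ ka) (hka₂ : ka ≤ k₂) {H : Site 2 → ℂ} (hH : IsPotential Λ (floorEdge ka m) H)
    {k : ℤ} (hk : ka < k) (n : ℕ) (hkn : k + n ≤ k₂ + 1) :
    (H ![k + (n : ℤ), m]).re - (H ![k, m]).re = Real.sqrt 3 / 6 * Real.sin (3 / 8 * Real.pi) *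
      ∑ i ∈ range n, ‖hexParafermionicObservable Λ (floorEdge ka m) hexCriticalFugacity 0
        (floorEdge (k + (i : ℤ)) m)‖ := by
  induction n with
  | zero => simp
  | succ n ih =>
    have hkn' : k + (n : ℤ) ≤ k₂ + 1 := by push_cast at hkn; linarith
    have h1 : k₁ ≤ k + (n : ℤ) := by have : (0 : ℤ) ≤ n := Int.natCast_nonneg n; linarith
    have h2 : k + (n : ℤ) ≤ k₂ := by push_cast at hkn; linarith
    have hstep := (re_floor_step hΛ hF hka₁ hka₂ hH h1 h2).1 (by linarith)
    rw [Complex.sub_re] at hstep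
    rw [site_east_succ, sum_range_succ, mul_add, ← ih hkn', ← hstep]
    ring

/-- **West floor profile**: west of the root `Re H` increases WESTwards by exactly `K · Z` per crossed
floor dart: for `k₁ ≤ k` and `k + n ≤ ka`,
`Re H(![k, m]) − Re H(![k+n, m]) = K · Σ_{i<n} Z(floorEdge (k+i) m)`.
[cite: DuminilCopinSmirnov2012, §3–§4 (winding of walks to the boundary; the map H)] -/
theorem re_floor_profile_west {Λ : Finset HexVertex} (hΛ : hexDomainSimplyConnected Λ)
    {m k₁ k₂ ka : ℤ}
    (hF : ∀ k : ℤ, k₁ ≤ k → k ≤ k₂ → ((![k, m], 0) : HexVertex) ∈ Λ ∧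
      ((![k, m - 1], 1) : HexVertex) ∉ Λ ∧ (k < k₂ → ((![k, m], 1) : HexVertex) ∈ Λ))
    (hka₁ : k₁ ≤ ka) (hka₂ : ka ≤ k₂) {H : Site 2 → ℂ} (hH : IsPotential Λ (floorEdge ka m) H)
    {k : ℤ} (hk : k₁ ≤ k) (n : ℕ) (hkn : k + n ≤ ka) :
    (H ![k, m]).re - (H ![k + (n : ℤ), m]).re = Real.sqrt 3 / 6 * Real.sin (3 / 8 * Real.pi) *
      ∑ i ∈ range n, ‖hexParafermionicObservable Λ (floorEdge ka m) hexCriticalFugacity 0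
        (floorEdge (k + (i : ℤ)) m)‖ := by
  induction n with
  | zero => simp
  | succ n ih =>
    have hkn' : k + (n : ℤ) ≤ ka := by push_cast at hkn; linarith
    have h1 : k₁ ≤ k + (n : ℤ) := by have : (0 : ℤ) ≤ n := Int.natCast_nonneg n; linarith
    have hlt : k + (n : ℤ) < ka := by push_cast at hkn; linarith
    have h2 : k + (n : ℤ) ≤ k₂ := by linarith
    have hstep := (re_floor_step hΛ hF hka₁ hka₂ hH h1 h2).2 hlt
    rw [Complex.sub_re] at hstep
    rw [site_east_succ, sum_range_succ, mul_add, ← ih hkn']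
    linarith

/-! ### 22. Registered form: monotone floor profile with mass-bounded increments -/

/-- **Registered sub-goal `pickEngine_floorProfile`** (crux item stmt-CriticalPhenomena-14004, line
`pick-half-plane`, engine input S3-b): for a potential `H` rooted at the floor dart `floorEdge ka mr`
inside a (no-pinch) exact flat floor `k₁ … k₂` of row `mr` of a simply connected `Λ`, `Re H` is
monotone along each arm, increasing away from the root, with increments at most `K` times the
crossed floor-dart masses: EAST, for `ka < k`, `k + n ≤ k₂ + 1`:
`0 ≤ Re H(![k+n, mr]) − Re H(![k, mr]) ≤ K Σ_{i<n} Z(floorEdge (k+i) mr)`; WEST, for `k₁ ≤ k`,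
`k + n ≤ ka`: `0 ≤ Re H(![k, mr]) − Re H(![k+n, mr]) ≤ K Σ_{i<n} Z(floorEdge (k+i) mr)`
(`K = (√3/6)·sin(3π/8)`; both are equalities, `re_floor_profile_east/west`).
[cite: DuminilCopinSmirnov2012, §3–§4 (winding of walks to the boundary; the map H)] -/
theorem pickEngine_floorProfile : ∀ (Λ : Finset HexVertex), hexDomainSimplyConnected Λ → ∀ (mr k₁ k₂ ka : ℤ), (∀ k : ℤ, k₁ ≤ k → k ≤ k₂ → ((![k, mr], 0) : HexVertex) ∈ Λ ∧ ((![k, mr - 1], 1) : HexVertex) ∉ Λ ∧ (k < k₂ → ((![k, mr], 1) : HexVertex) ∈ Λ) ∧ ((![k, mr - 1], 0) : HexVertex) ∉ Λ) → k₁ ≤ ka → ka ≤ k₂ → ∀ (H : Site 2 → ℂ), IsPotential Λ (floorEdge ka mr) H → (∀ (k : ℤ) (n : ℕ), ka < k → k + n ≤ k₂ + 1 → 0 ≤ (H ![k + (n : ℤ), mr]).re - (H ![k, mr]).re ∧ (H ![k + (n : ℤ), mr]).re - (H ![k, mr]).re ≤ Real.sqrt 3 / 6 * Real.sin (3 / 8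 * Real.pi) * ∑ i ∈ Finset.range n, ‖hexParafermionicObservable Λ (floorEdge ka mr) hexCriticalFugacity 0 (floorEdge (k + (i : ℤ)) mr)‖) ∧ (∀ (k : ℤ) (n : ℕ), k₁ ≤ k → k + n ≤ ka → 0 ≤ (H ![k, mr]).re - (H ![k + (n : ℤ), mr]).re ∧ (H ![k, mr]).re - (H ![k + (n : ℤ), mr]).re ≤ Real.sqrt 3 / 6 * Real.sin (3 / 8 * Real.pi) * ∑ i ∈ Finset.range n, ‖hexParafermionicObservable Λ (floorEdge ka mr) hexCriticalFugacity 0 (floorEdge (k + (i : ℤ)) mr)‖) := by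
  intro Λ hΛ mr k₁ k₂ ka hF4 hka₁ hka₂ H hH
  have hF : ∀ k : ℤ, k₁ ≤ k → k ≤ k₂ → ((![k, mr], 0) : HexVertex) ∈ Λ ∧
      ((![k, mr - 1], 1) : HexVertex) ∉ Λ ∧ (k < k₂ → ((![k, mr], 1) : HexVertex) ∈ Λ) :=
    fun k h1 h2 => ⟨(hF4 k h1 h2).1, (hF4 k h1 h2).2.1, (hF4 k h1 h2).2.2.1⟩
  have hK := floorStepConst_pos
  have hZ : ∀ (k : ℤ) (n : ℕ), 0 ≤ ∑ i ∈ Finset.range n, ‖hexParafermionicObservable Λ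
      (floorEdge ka mr) hexCriticalFugacity 0 (floorEdge (k + (i : ℤ)) mr)‖ :=
    fun k n => sum_nonneg fun i _ => norm_nonneg _
  refine ⟨fun k n hk hkn => ?_, fun k n hk hkn => ?_⟩
  · rw [re_floor_profile_east hΛ hF hka₁ hka₂ hH hk n hkn]
    exact ⟨mul_nonneg hK.le (hZ k n), le_rfl⟩
  · rw [re_floor_profile_west hΛ hF hka₁ hka₂ hH hk n hkn]
    exact ⟨mul_nonneg hK.le (hZ k n), le_rfl⟩

end Summit.CriticalPhenomena.SAWScalingLimit.Theorems.PickHalfPlane.GateMass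

end
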